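import Summits.QuantumAdvantage.QuantumAdvantage.Theorems.CubicForrelationNearExactIsExactTwelveLevelFiveHyperplaneGe2932
import Summits.QuantumAdvantage.QuantumAdvantage.Theorems.CubicForrelationNearExactIsExactTwelveWildParity
import Summits.QuantumAdvantage.QuantumAdvantage.Theorems.CubicForrelationNearExactIsExactFlatSumsGeneral

/-!
# Crux `CubicForrelation.NearExactIsExact` (stmt-QuantumAdvantage-14043) — n = 12: FLAT CONGRUENCES for the residual of a level-5 side,
  and the setup of the level-5 branch at the boundary rung `Φ ≥ 29/32`

Certificate seat `b2b-cforr-cert` (gen 23).  HONEST FRAMING: infrastructure lemmas (standard axioms, no `decide`) for the level-5 branch of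
the value `Φ = 29/32` on 12 bits (HOME/b2b-cforr-cert-g23/PROOF-N12-928-L5.md §1); NOT summit progress, NO new value of `θ₁₂`.

For cubic `f, g` on 12 bits with `W_g = 32u'` (level `≥ 5`), the residual `e = u' − 2(−1)^f` satisfies, on EVERY parametrised `k`-flat
(any base point, any `k` directions, independence not needed):
  `Σ_flat e ≡ 0 (mod 2^m)` whenever `5 + m ≤ k + ⌈(12−k)/3⌉` and `m ≤ ⌈k/3⌉ + 1`
(`fs_flat_sum_dvd` for `u'` and Ax on the pulled-back cubic `f`, `fs_sum_signOf_flat_dvd`) — so `mod 4, 8, 8, 16, 16, 16, 32` for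
`k = 4, 5, 6, 7, 8, 9, 10` (`l5c_flat_sum`, `l5c_flat4` … `l5c_flat10`).  `l5c_sum_split` peels the first direction off a parametrised
flat sum (the "straddling" trick: a `k`-flat inside the odd hyperplane `P` plus its translate by a direction `w ∉ dir P`).
`l5c_setup` packages the standard data of a level-5 side at `Φ ≥ 29/32`: the odd set `P` (2048 points) is a coset `x_P ⊕ V` of its
xor-closed period group `V` (`#V = 2¹¹`), its complement is the coset `x' ⊕ V`, `e` is odd with `e² ≥ 1` on `P` and even off `P`, and
`Σ_P e² + Σ_{P'} e² = Σ e² = 2¹⁵(1 − Φ) ≤ 3072`, whence the off-hyperplane energy `Σ_{P'} e² ≤ 1024`.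

References: J. Ax (1964) / R. J. McEliece (1972); MacWilliams–Sloane (1977) Ch. 13–15.  Axioms: the standard three.
-/

set_option linter.dupNamespace false -- D-0017: single-problem summit ⇒ `QuantumAdvantage.QuantumAdvantage` by design

noncomputable section

namespace Summit.QuantumAdvantage.QuantumAdvantage.Theorems.CubicForrelation.NearExactIsExact

open Finset
open Literature.Computability.QuantumComplexity
open Literature.Computability.QuantumComplexity.BuzetChailloux (bxor zeroVec bxor_bxor_cancel_left bxor_zeroVec zeroVec_bxor bxor_comm
  bxor_self twist_zeroVec_right twist_bxor_right)
open Literature.Computability.QuantumComplexity.DerivativeWalsh (W twist_bxor_left)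
open Literature.Computability.QuantumComplexity.Simon (twist_eq_one_or)

/-! ### Flat congruences for the residual of a level-5 side -/

/-- **Flat congruence for the level-5 residual.**  Cubic `f, g` on 12 bits, `W_g = 32u'`: for every parametrised `k`-flat and every `m`
with `5 + m ≤ k + ⌈(12−k)/3⌉` and `m ≤ ⌈k/3⌉ + 1`, `2^m ∣ Σ_flat (u' − 2(−1)^f)`. [this work] -/
theorem l5c_flat_sum {k m : ℕ} (f g : (Fin (6 + 6) → Bool) → Bool) (hf : IsDegLeFun 3 f) (hg : IsDegLeFun 3 g)
    (u' : (Fin (6 + 6) → Bool) → ℤ) (hu' : ∀ x, W (fun y => signOf (g y)) x = (2 : ℝ) ^ 5 * (u' x : ℝ))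
    (h1 : 5 + m ≤ k + (6 + 6 - k + 2) / 3) (h2 : m ≤ (k + 2) / 3 + 1)
    (b : Fin (6 + 6) → Bool) (a : Fin k → Fin (6 + 6) → Bool) :
    (2 : ℤ) ^ m ∣ ∑ ε : Fin k → Bool,
      (u' (fun j => b j ^^ decide (Odd #(univ.filter fun i => ε i && a i j))) -
        2 * sZ (f (fun j => b j ^^ decide (Odd #(univ.filter fun i => ε i && a i j))))) := by
  classical
  have hU := fs_flat_sum_dvd (e := m) g u' hg hu' b a h1
  obtain ⟨z, hz⟩ := fs_sum_signOf_flat_dvd f hf b a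
  have hz' : ∑ ε : Fin k → Bool, sZ (f (fun j => b j ^^ decide (Odd #(univ.filter fun i => ε i && a i j)))) =
      2 ^ ((k + 2) / 3) * z := by
    have h : ((∑ ε : Fin k → Bool, sZ (f (fun j => b j ^^ decide (Odd #(univ.filter fun i => ε i && a i j)))) : ℤ) : ℝ) =
        ((2 ^ ((k + 2) / 3) * z : ℤ) : ℝ) := by
      push_cast
      rw [sum_congr rfl fun ε _ => tp_sZ_cast _, hz]
    exact_mod_cast h
  rw [sum_sub_distrib, ← mul_sum, hz']
  refine dvd_sub hU ?_
  rw [show (2 : ℤ) * (2 ^ ((k + 2) / 3) * z) = 2 ^ ((k + 2) / 3 + 1) * z by ring]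
  exact dvd_mul_of_dvd_left (pow_dvd_pow 2 h2) z

/-- `k = 4`: every parametrised 4-flat sum of the residual is `≡ 0 (mod 4)`. [this work] -/
theorem l5c_flat4 (f g : (Fin (6 + 6) → Bool) → Bool) (hf : IsDegLeFun 3 f) (hg : IsDegLeFun 3 g)
    (u' : (Fin (6 + 6) → Bool) → ℤ) (hu' : ∀ x, W (fun y => signOf (g y)) x = (2 : ℝ) ^ 5 * (u' x : ℝ))
    (b : Fin (6 + 6) → Bool) (a : Fin 4 → Fin (6 + 6) → Bool) :
    (4 : ℤ) ∣ ∑ ε : Fin 4 → Bool,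
      (u' (fun j => b j ^^ decide (Odd #(univ.filter fun i => ε i && a i j))) -
        2 * sZ (f (fun j => b j ^^ decide (Odd #(univ.filter fun i => ε i && a i j))))) := by
  have h := l5c_flat_sum (k := 4) (m := 2) f g hf hg u' hu' (by norm_num) (by norm_num) b a
  rw [show ((2 : ℤ) ^ 2) = 4 by norm_num] at h
  exact h

/-- `k = 5`: every parametrised 5-flat sum of the residual is `≡ 0 (mod 8)`. [this work] -/
theorem l5c_flat5 (f g : (Fin (6 + 6) → Bool) → Bool) (hf : IsDegLeFun 3 f) (hg : IsDegLeFun 3 g)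
    (u' : (Fin (6 + 6) → Bool) → ℤ) (hu' : ∀ x, W (fun y => signOf (g y)) x = (2 : ℝ) ^ 5 * (u' x : ℝ))
    (b : Fin (6 + 6) → Bool) (a : Fin 5 → Fin (6 + 6) → Bool) :
    (8 : ℤ) ∣ ∑ ε : Fin 5 → Bool,
      (u' (fun j => b j ^^ decide (Odd #(univ.filter fun i => ε i && a i j))) -
        2 * sZ (f (fun j => b j ^^ decide (Odd #(univ.filter fun i => ε i && a i j))))) := by
  have h := l5c_flat_sum (k := 5) (m := 3) f g hf hg u' hu' (by norm_num) (by norm_num) b a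
  rw [show ((2 : ℤ) ^ 3) = 8 by norm_num] at h
  exact h

/-- `k = 7`: every parametrised 7-flat sum of the residual is `≡ 0 (mod 16)`. [this work] -/
theorem l5c_flat7 (f g : (Fin (6 + 6) → Bool) → Bool) (hf : IsDegLeFun 3 f) (hg : IsDegLeFun 3 g)
    (u' : (Fin (6 + 6) → Bool) → ℤ) (hu' : ∀ x, W (fun y => signOf (g y)) x = (2 : ℝ) ^ 5 * (u' x : ℝ))
    (b : Fin (6 + 6) → Bool) (a : Fin 7 → Fin (6 + 6) → Bool) :
    (16 : ℤ) ∣ ∑ ε : Fin 7 → Bool,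
      (u' (fun j => b j ^^ decide (Odd #(univ.filter fun i => ε i && a i j))) -
        2 * sZ (f (fun j => b j ^^ decide (Odd #(univ.filter fun i => ε i && a i j))))) := by
  have h := l5c_flat_sum (k := 7) (m := 4) f g hf hg u' hu' (by norm_num) (by norm_num) b a
  rw [show ((2 : ℤ) ^ 4) = 16 by norm_num] at h
  exact h

/-- `k = 10`: every parametrised 10-flat sum of the residual is `≡ 0 (mod 32)`. [this work] -/
theorem l5c_flat10 (f g : (Fin (6 + 6) → Bool) → Bool) (hf : IsDegLeFun 3 f) (hg : IsDegLeFun 3 g)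
    (u' : (Fin (6 + 6) → Bool) → ℤ) (hu' : ∀ x, W (fun y => signOf (g y)) x = (2 : ℝ) ^ 5 * (u' x : ℝ))
    (b : Fin (6 + 6) → Bool) (a : Fin 10 → Fin (6 + 6) → Bool) :
    (32 : ℤ) ∣ ∑ ε : Fin 10 → Bool,
      (u' (fun j => b j ^^ decide (Odd #(univ.filter fun i => ε i && a i j))) -
        2 * sZ (f (fun j => b j ^^ decide (Odd #(univ.filter fun i => ε i && a i j))))) := by
  have h := l5c_flat_sum (k := 10) (m := 5) f g hf hg u' hu' (by norm_num) (by norm_num) b a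
  rw [show ((2 : ℤ) ^ 5) = 32 by norm_num] at h
  exact h

/-! ### Peeling the first direction off a parametrised flat sum -/

/-- Translating the base point of a parametrised flat. [folklore] -/
theorem l5c_flatPt_shift {k n : ℕ} (b t : Fin n → Bool) (a : Fin k → Fin n → Bool) (ε : Fin k → Bool) :
    (fun j => (b j ^^ decide (Odd #(univ.filter fun i => ε i && a i j))) ^^ (true && t j)) =
      fun j => bxor b t j ^^ decide (Odd #(univ.filter fun i => ε i && a i j)) := by
  funext j
  simp only [Bool.true_and, bxor]
  cases b j <;> cases t j <;> cases decide (Odd #(univ.filter fun i => ε i && a i j)) <;> rfl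

/-- **Peeling a direction**: the sum of `F` over the parametrised `(k+1)`-flat with directions `(t, a₀, …, a_{k−1})` is the sum over the
`k`-flat `(a₀,…,a_{k−1})` based at `b` plus the sum over the same `k`-flat based at `b ⊕ t`. [folklore] -/
theorem l5c_sum_split {k n : ℕ} {M : Type*} [AddCommMonoid M] (F : (Fin n → Bool) → M) (b t : Fin n → Bool)
    (a : Fin k → Fin n → Bool) :
    ∑ ε : Fin (k + 1) → Bool, F (fun j => b j ^^ decide (Odd #(univ.filter fun i : Fin (k + 1) =>
        ε i && (Fin.cons t a : Fin (k + 1) → Fin n → Bool) i j))) =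
      ∑ ε : Fin k → Bool, F (fun j => b j ^^ decide (Odd #(univ.filter fun i => ε i && a i j))) +
        ∑ ε : Fin k → Bool, F (fun j => bxor b t j ^^ decide (Odd #(univ.filter fun i => ε i && a i j))) := by
  rw [tep_sum_split]
  congr 1
  · refine Fintype.sum_congr _ _ fun ε => ?_
    rw [erm_flatPt_cons]
    congr 1
    funext j
    simp
  · refine Fintype.sum_congr _ _ fun ε => ?_
    rw [erm_flatPt_cons, l5c_flatPt_shift]

/-! ### The setup of a level-5 side at `Φ ≥ 29/32` -/

/-- **Setup of a level-5 side at `Φ ≥ 29/32`** (12 bits): cubic `f, g`, `W_g = 32u'`, some `u'(x)` odd, `Φ(f,g) ≥ 29/32`.  Then the odd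
set `P` of `u'` is a coset `x_P ⊕ V` of an xor-closed `V ∋ 0` with `#V = 2¹¹`, `#P = 2048`, its complement is the coset `x' ⊕ V`, and with
`e = u' − 2(−1)^f`: `e² ≥ 1` on `P`, `e` is even off `P`, and `Σ_P e² + Σ_{off P} e² ≤ 3072`; in particular the off-hyperplane energy is
`≤ 1024`. [this work] -/
theorem l5c_setup (f g : (Fin (6 + 6) → Bool) → Bool) (hg : IsDegLeFun 3 g)
    (u' : (Fin (6 + 6) → Bool) → ℤ) (hu' : ∀ x, W (fun y => signOf (g y)) x = (2 : ℝ) ^ 5 * (u' x : ℝ))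
    (hodd : ∃ x, Odd (u' x)) (hΦ : (29 / 32 : ℝ) ≤ forrelation f g) :
    ∃ (V : Finset (Fin (6 + 6) → Bool)) (xP x' : Fin (6 + 6) → Bool),
      zeroVec ∈ V ∧ (∀ a ∈ V, ∀ b ∈ V, bxor a b ∈ V) ∧ #V = 2 ^ 11 ∧
      (univ.filter fun x : Fin (6 + 6) → Bool => Odd (u' x)) = V.image (bxor xP) ∧
      (univ.filter fun x : Fin (6 + 6) → Bool => ¬ Odd (u' x)) = V.image (bxor x') ∧
      #(univ.filter fun x : Fin (6 + 6) → Bool => Odd (u' x)) = 2048 ∧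
      #(univ.filter fun x : Fin (6 + 6) → Bool => ¬ Odd (u' x)) = 2048 ∧
      (∀ x, Odd (u' x) → 1 ≤ (u' x - 2 * sZ (f x)) ^ 2) ∧
      (∀ x, ¬ Odd (u' x) → Even (u' x - 2 * sZ (f x))) ∧
      (∑ x ∈ univ.filter (fun x : Fin (6 + 6) → Bool => Odd (u' x)), (u' x - 2 * sZ (f x)) ^ 2 +
        ∑ x ∈ univ.filter (fun x : Fin (6 + 6) → Bool => ¬ Odd (u' x)), (u' x - 2 * sZ (f x)) ^ 2 ≤ 3072) ∧
      ∑ x ∈ univ.filter (fun x : Fin (6 + 6) → Bool => ¬ Odd (u' x)), (u' x - 2 * sZ (f x)) ^ 2 ≤ 1024 := by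
  classical
  -- budget `Σ e² = 2¹⁵(1 − Φ) ≤ 3072`
  set u : (Fin (6 + 6) → Bool) → ℤ := fun x => 2 * u' x with hudef
  have hu : ∀ x, W (fun y => signOf (g y)) x = (2 : ℝ) ^ 4 * (u x : ℝ) := by
    intro x; rw [hu' x]; simp only [u]; push_cast; ring
  set e : (Fin (6 + 6) → Bool) → ℤ := fun x => u' x - 2 * sZ (f x) with hedef
  have hbud := tw12_budget f g u hu
  have h4e : ∀ x, (u x - 4 * sZ (f x)) ^ 2 = 4 * e x ^ 2 := fun x => by simp only [u, e]; ring
  have hBR : ((∑ x, e x ^ 2 : ℤ) : ℝ) = 32768 * (1 - forrelation f g) := by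
    have h' : ((∑ x, (u x - 4 * sZ (f x)) ^ 2 : ℤ) : ℝ) = 4 * ((∑ x, e x ^ 2 : ℤ) : ℝ) := by
      rw [sum_congr rfl fun x _ => h4e x, ← mul_sum]; push_cast; ring
    rw [h'] at hbud
    linarith
  have hB_le : (∑ x, e x ^ 2 : ℤ) ≤ 3072 := by
    have h' : ((∑ x, e x ^ 2 : ℤ) : ℝ) ≤ 3072 := by rw [hBR]; linarith
    exact_mod_cast h'
  -- the odd set `P`: 2048 points, a coset of its period group
  set P := univ.filter (fun x : Fin (6 + 6) → Bool => Odd (u' x)) with hPdef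
  have hmemP : ∀ x, x ∈ P ↔ Odd (u' x) := fun x => by simp [hPdef]
  have hcardP : #P = 2048 := tw22_oddset_card_ge2932 f g hg u' hu' hodd hΦ
  have hℓ : IsDegLeFun 1 (fun x => decide (Odd (u' x))) :=
    stub_walshTower stub_axParity (6 + 6) 5 1 g u' hg hu' (by intro k hk hkn; omega)
  have hfilt : (univ.filter fun x : Fin (6 + 6) → Bool => decide (Odd (u' x)) = true) = P := filter_congr fun x _ => by simp
  have hmw := mw_flat_of_minweight 0 (fun x => decide (Odd (u' x))) hℓ (by rw [hfilt, hcardP]; norm_num)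
  rw [hfilt] at hmw
  obtain ⟨h0, hadd, hcardV, hcoset⟩ := hmw
  set V := univ.filter (fun a : Fin (6 + 6) → Bool => ∀ x, decide (Odd (u' (bxor x a))) = decide (Odd (u' x))) with hV
  obtain ⟨xP, hxP⟩ : P.Nonempty := card_pos.1 (by rw [hcardP]; norm_num)
  have hS : P = V.image (bxor xP) := hcoset xP (decide_eq_true ((hmemP xP).1 hxP))
  rw [hcardP] at hcardV
  have hcardV11 : #V = 2 ^ 11 := by rw [hcardV]; norm_num
  -- the complement `P'`: also 2048 points, the coset of any of its points
  set P' := univ.filter (fun x : Fin (6 + 6) → Bool => ¬ Odd (u' x)) with hP'def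
  have hPP' : #P + #P' = 4096 := by
    have h := Finset.card_filter_add_card_filter_not (s := (univ : Finset (Fin (6 + 6) → Bool))) (fun x => Odd (u' x))
    rw [card_univ, Fintype.card_fun, Fintype.card_bool, Fintype.card_fin] at h
    rw [show (2 : ℕ) ^ (6 + 6) = 4096 by norm_num] at h
    exact h
  have hcardP' : #P' = 2048 := by omega
  obtain ⟨x', hx'⟩ : P'.Nonempty := card_pos.1 (by rw [hcardP']; norm_num)
  have hx'P : x' ∉ P := by rw [hmemP]; exact (mem_filter.1 hx').2
  have hsub : V.image (bxor x') ⊆ P' := by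
    intro y hy
    obtain ⟨a, ha, rfl⟩ := mem_image.1 hy
    have hout : bxor x' a ∉ P := fl1_coset_out' hadd hS hx'P ha
    rw [hP'def, mem_filter]
    exact ⟨mem_univ _, fun h => hout ((hmemP _).2 h)⟩
  have hS' : P' = V.image (bxor x') := by
    symm
    apply eq_of_subset_of_card_le hsub
    rw [card_image_of_injective _ (iw_bxor_injective x'), hcardV, hcardP']
  -- residual facts
  have hsq1 : ∀ x, Odd (u' x) → 1 ≤ e x ^ 2 := by
    intro x hx
    have hodd' : Odd (e x) := Int.odd_sub.2 (iff_of_true hx ⟨sZ (f x), two_mul _⟩)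
    have h0' := Int.odd_iff.1 hodd'
    have : e x ≤ -1 ∨ 1 ≤ e x := by omega
    have := tp_sq_ge (k := 1) (by norm_num) this
    linarith
  have heven : ∀ x, ¬ Odd (u' x) → Even (e x) := by
    intro x hx
    exact Int.even_sub.2 (iff_of_true (Int.not_odd_iff_even.1 hx) ⟨sZ (f x), two_mul _⟩)
  have hsplit : (∑ x, e x ^ 2 : ℤ) = ∑ x ∈ P, e x ^ 2 + ∑ x ∈ P', e x ^ 2 := by
    rw [hPdef, hP'def, ← sum_filter_add_sum_filter_not univ (fun x => Odd (u' x))]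
  have hPsum_ge : (2048 : ℤ) ≤ ∑ x ∈ P, e x ^ 2 := by
    have h1 : ∑ x ∈ P, (1 : ℤ) ≤ ∑ x ∈ P, e x ^ 2 := sum_le_sum fun x hx => hsq1 x ((hmemP x).1 hx)
    rw [sum_const, nsmul_eq_mul, mul_one, hcardP] at h1
    exact_mod_cast h1
  refine ⟨V, xP, x', h0, hadd, hcardV11, hS, hS', hcardP, hcardP', hsq1, heven, ?_, ?_⟩
  · rw [← hsplit]; exact hB_le
  · linarith [hsplit.symm.le.trans hB_le]

end Summit.QuantumAdvantage.QuantumAdvantage.Theorems.CubicForrelation.NearExactIsExact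

end
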